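import Summits.RiemannHypothesis.RiemannHypothesis.Theorems.WeilFormatCDeflatedFarSectorEven
import Summits.RiemannHypothesis.RiemannHypothesis.Theorems.WeilFormatCDeflatedFarSectorOdd
import Summits.RiemannHypothesis.RiemannHypothesis.Theorems.WeilFormatCWindowReflect
import Summits.RiemannHypothesis.RiemannHypothesis.Theorems.WeilFormatCPolyWindowEntry
import HarnessLib

/-!
# Format C, design C∞ (E3, analytic side): the images of the DoorB certificates in terms of the monomial images

Route context: Fourier–Galerkin / Schur-complement certificates of Weil positivity on a window ("format C", C∞ door;
cell memo `run/shared/lean/pub/rh-explicit/rh-explicit-weil-10/KERNEL-LEVER.md` §21; supporting stmt-RiemannHypothesis-0098;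
seat rh-explicit-weil-10).  The image entries of the coupling column of `weilPositivityOn_of_formatC_cinfB/BA` are
`Re W_a(φ − proj_B φ, w⁺_m)/d_m` (even sector, `φ = 1f_j` an even real window, `m > B`) and
`Im W_a(φ − proj_B φ, w⁻_{m+1})/√2` (odd sector).  Here they are reduced to the objects whose monomial forms are
in the tree (`WeilFormatCCinfImageMonomials`, `WeilFormatCCinfRowMonomials`):

* `re_weilWindowSesq_sub_proj_chiEven_div` — `Re W(φ − proj_B φ, w⁺_m)/d_m = Re W(φ, w⁺_m)/d_m − Σ_{n≤B} M⁺(n,m)·V⁺_φ(n)`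
  (`V⁺_φ(n) = d_n² Re ĉ_n(φ)/√(2a)`; the row identity of `WeilFormatCDeflatedFarSectorEven` down to mode `0`);
* `im_weilWindowSesq_sub_proj_chiOdd_div` — `Im W(φ − proj_B φ, w⁻_{m+1})/√2 = Im W(φ, w⁻_{m+1})/√2 − Σ_{k<B} M⁻(k,m)·V⁻_φ(k)`
  (`proj_0 φ = 0` for odd `φ`);
* `re_weilWindowSesq_indicator_poly_chiEven_div`, `im_weilWindowSesq_indicator_poly_chiOdd_div` — for a polynomial
  profile `f = Σ_q c_q x^q` with real coefficients: `Re W(1f, w⁺_m)/√2 = Σ_q c_q (1 + (−1)^q)/2 · Re W(1x^q, χ_m)`,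
  `Im W(1f, w⁻_m)/√2 = Σ_q c_q (1 − (−1)^q)/2 · Im W(1x^q, χ_m)` (`m ≠ 0`; `WeilFormatCWindowReflect`).

So the far image of a polynomial profile is (block rows × the profile's V-table, both in monomial form) plus a real
combination of the monomial images `Re/Im W(1x^q, χ_m)`.  Pure algebra over the landed sector identities; standard
axioms; no definitions; no RH claim.
-/

set_option autoImplicit false
-- `Summit.RiemannHypothesis.RiemannHypothesis.…` is the layout-mandated namespace (summit = problem name).
set_option linter.dupNamespace false

noncomputable section

open Complex Filter Set MeasureTheory
open scoped Real Topology ComplexConjugate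

namespace Summit.RiemannHypothesis.RiemannHypothesis.Theorems.WeilFormatC

open Literature.NumberTheory.LFunctions Literature.NumberTheory.LFunctions.Yoshida1992

variable {a : ℝ}

/-! ## Even sector: removing the projection -/

/-- **`W_a(proj_B φ, w⁺_m)` on the even basis** (`a > 0`, `φ` even real, `B < m`):
`Re W_a(proj_B φ, w⁺_m)/d_m = Σ_{n∈[0,B]} M⁺(n,m)·V⁺_φ(n)`. -/
theorem re_weilWindowSesq_proj_chiEven_div (ha : 0 < a) {φ : ℝ → ℂ} (hφ : ∀ x, φ (-x) = φ x)
    (hφr : ∀ x, conj (φ x) = φ x) {B m : ℕ} (hBm : B < m) :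
    (weilWindowSesq a (proj a B φ) (chiEven a m)).re / (if m = 0 then 1 else Real.sqrt 2)
      = ∑ n ∈ Finset.range (B + 1),
          (if n = 0 then gramCoeff a 0 m else if m = 0 then gramCoeff a n 0
            else (gramCoeff a n m + gramCoeff a n (-(m : ℤ))) / 2) *
          ((if n = 0 then 1 else 2) * (Yoshida1992.fourierCoeff a n φ).re / Real.sqrt (2 * a)) := by
  have hm0 : m ≠ 0 := by omega
  have hs0 : (0 : ℝ) < Real.sqrt 2 := Real.sqrt_pos.2 (by norm_num)
  have hs2 : Real.sqrt 2 * Real.sqrt 2 = 2 := Real.mul_self_sqrt (by norm_num)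
  simp only [if_neg hm0]
  rw [div_eq_iff hs0.ne', proj_eq_sum_chiEven hφ a B,
    weilWindowSesq_sum_left ha.le _ (fun i _ ↦ isWindowFunction_chiEven ha i) (isWindowFunction_chiEven ha m) _ a]
  simp_rw [zeta_eq_ofReal hφ hφr, weilWindowSesq_chiEven_chiEven ha, ← Complex.ofReal_mul]
  rw [← Complex.ofReal_sum, Complex.ofReal_re, Finset.sum_mul]
  refine Finset.sum_congr rfl fun n _ ↦ ?_
  simp only [if_neg hm0]
  split_ifs with hn
  · subst hn; ring
  · linear_combination ((gramCoeff a n m + gramCoeff a n (-(m : ℤ))) / 2 *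
      (Yoshida1992.fourierCoeff a n φ).re * Real.sqrt 2 / Real.sqrt (2 * a)) * hs2

/-- **Removing the projection, even sector** (`a > 0`, `φ` an even real window function, `B < m`):
`Re W_a(φ − proj_B φ, w⁺_m)/d_m = Re W_a(φ, w⁺_m)/d_m − Σ_{n∈[0,B]} M⁺(n,m)·V⁺_φ(n)` — the image entry of the C∞
coupling column is the profile's full image minus block rows times the profile's table. -/
theorem re_weilWindowSesq_sub_proj_chiEven_div (ha : 0 < a) {φ : ℝ → ℂ} (hφ : ∀ x, φ (-x) = φ x)
    (hφr : ∀ x, conj (φ x) = φ x) (hφw : IsWindowFunction a φ) {B m : ℕ} (hBm : B < m) :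
    (weilWindowSesq a (φ - proj a B φ) (chiEven a m)).re / (if m = 0 then 1 else Real.sqrt 2)
      = (weilWindowSesq a φ (chiEven a m)).re / (if m = 0 then 1 else Real.sqrt 2)
        - ∑ n ∈ Finset.range (B + 1),
            (if n = 0 then gramCoeff a 0 m else if m = 0 then gramCoeff a n 0
              else (gramCoeff a n m + gramCoeff a n (-(m : ℤ))) / 2) *
            ((if n = 0 then 1 else 2) * (Yoshida1992.fourierCoeff a n φ).re / Real.sqrt (2 * a)) := by
  rw [weilWindowSesq_sub_left ha.le hφw (isWindowFunction_proj ha B φ) (isWindowFunction_chiEven ha m),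
    Complex.sub_re, sub_div, re_weilWindowSesq_proj_chiEven_div ha hφ hφr hBm]

/-! ## Odd sector: removing the projection -/

/-- An odd window has no constant mode: `proj_0 φ = 0`. -/
theorem proj_zero_eq_zero_of_odd (a : ℝ) {φ : ℝ → ℂ} (hφ : ∀ x, φ (-x) = -φ x) : proj a 0 φ = 0 := by
  have h0 : Yoshida1992.fourierCoeff a 0 φ = 0 := by
    have h := fourierCoeff_neg_eq_neg_of_odd hφ a 0
    rw [neg_zero] at h
    have : (2 : ℂ) * Yoshida1992.fourierCoeff a 0 φ = 0 := by linear_combination h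
    simpa using this
  unfold proj
  rw [show modes 0 = {0} by rfl, Finset.sum_singleton, h0, mul_zero, zero_smul]

/-- **Removing the projection, odd sector** (`a > 0`, `φ` an odd real window function, any `B`, `m`):
`Im W_a(φ − proj_B φ, w⁻_{m+1})/√2 = Im W_a(φ, w⁻_{m+1})/√2 − Σ_{k∈[0,B)} M⁻(k,m)·V⁻_φ(k)` with the odd kernel
`M⁻(k,m) = (G(k+1,m+1) − G(k+1,−(m+1)))/2` and `V⁻_φ(k) = 2 Im ĉ_{k+1}(φ)/√(2a)`. -/
theorem im_weilWindowSesq_sub_proj_chiOdd_div (ha : 0 < a) {φ : ℝ → ℂ} (hφ : ∀ x, φ (-x) = -φ x)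
    (hφr : ∀ x, conj (φ x) = φ x) (hφw : IsWindowFunction a φ) (B m : ℕ) :
    (weilWindowSesq a (φ - proj a B φ) (chiOdd a (m + 1))).im / Real.sqrt 2
      = (weilWindowSesq a φ (chiOdd a (m + 1))).im / Real.sqrt 2
        - ∑ k ∈ Finset.Ico 0 B,
            ((gramCoeff a ((k : ℤ) + 1) ((m : ℤ) + 1) - gramCoeff a ((k : ℤ) + 1) (-((m : ℤ) + 1))) / 2) *
            (2 * (Yoshida1992.fourierCoeff a ((k : ℤ) + 1) φ).im / Real.sqrt (2 * a)) := by
  rw [weilWindowSesq_sub_left ha.le hφw (isWindowFunction_proj ha B φ) (isWindowFunction_chiOdd ha (m + 1)),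
    Complex.sub_im, sub_div, sum_Ico_oddKernel_mul_eq ha hφ hφr (Nat.zero_le B) m,
    proj_zero_eq_zero_of_odd a hφ, sub_zero]

/-! ## Polynomial profiles against the sector bases -/

/-- **Even-sector image of a real polynomial profile** (`a > 0`, `m ≠ 0`, real coefficients `c_q`):
`Re W_a(1·Σ_q c_q x^q, w⁺_m)/√2 = Σ_q c_q·(1 + (−1)^q)/2·Re W_a(1x^q, χ_m)` (odd powers drop out). -/
theorem re_weilWindowSesq_indicator_poly_chiEven_div (ha : 0 < a) (s : Finset ℕ) (c : ℕ → ℝ) {m : ℕ}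
    (hm : m ≠ 0) :
    (weilWindowSesq a ((Icc (-a) a).indicator fun x : ℝ ↦ ∑ q ∈ s, ((c q : ℝ) : ℂ) * ((x : ℂ)) ^ q)
        (chiEven a m)).re / Real.sqrt 2
      = ∑ q ∈ s, c q * ((1 + (-1 : ℝ) ^ q) / 2) *
          (weilWindowSesq a ((Icc (-a) a).indicator fun x : ℝ ↦ ((x : ℂ)) ^ q) (chi a m)).re := by
  have hs0 : (0 : ℝ) < Real.sqrt 2 := Real.sqrt_pos.2 (by norm_num)
  rw [indicator_sum_mul_pow, weilWindowSesq_sum_left ha.le _ (fun q _ ↦ isWindowFunction_indicator_pow a q)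
    (isWindowFunction_chiEven ha m) _ a, Complex.re_sum, Finset.sum_div]
  refine Finset.sum_congr rfl fun q _ ↦ ?_
  rw [weilWindowSesq_indicator_pow_chiEven ha q hm,
    show ((c q : ℝ) : ℂ) * ((((1 / Real.sqrt 2 : ℝ) : ℂ)) * (1 + (-1 : ℂ) ^ q) *
        weilWindowSesq a ((Icc (-a) a).indicator fun x : ℝ ↦ ((x : ℂ)) ^ q) (chi a m))
      = (((c q * (1 / Real.sqrt 2) * (1 + (-1 : ℝ) ^ q) : ℝ)) : ℂ) *
        weilWindowSesq a ((Icc (-a) a).indicator fun x : ℝ ↦ ((x : ℂ)) ^ q) (chi a m) by push_cast; ring,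
    Complex.re_ofReal_mul, div_eq_iff hs0.ne']
  field_simp
  rw [Real.sq_sqrt (by norm_num : (0 : ℝ) ≤ 2)]
  ring

/-- **Odd-sector image of a real polynomial profile** (`a > 0`, real coefficients `c_q`, any mode index `i`):
`Im W_a(1·Σ_q c_q x^q, w⁻_i)/√2 = Σ_q c_q·(1 − (−1)^q)/2·Im W_a(1x^q, χ_i)` (even powers drop out). -/
theorem im_weilWindowSesq_indicator_poly_chiOdd_div (ha : 0 < a) (s : Finset ℕ) (c : ℕ → ℝ) (i : ℕ) :
    (weilWindowSesq a ((Icc (-a) a).indicator fun x : ℝ ↦ ∑ q ∈ s, ((c q : ℝ) : ℂ) * ((x : ℂ)) ^ q)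
        (chiOdd a i)).im / Real.sqrt 2
      = ∑ q ∈ s, c q * ((1 - (-1 : ℝ) ^ q) / 2) *
          (weilWindowSesq a ((Icc (-a) a).indicator fun x : ℝ ↦ ((x : ℂ)) ^ q) (chi a i)).im := by
  have hs0 : (0 : ℝ) < Real.sqrt 2 := Real.sqrt_pos.2 (by norm_num)
  rw [indicator_sum_mul_pow, weilWindowSesq_sum_left ha.le _ (fun q _ ↦ isWindowFunction_indicator_pow a q)
    (isWindowFunction_chiOdd ha i) _ a, Complex.im_sum, Finset.sum_div]
  refine Finset.sum_congr rfl fun q _ ↦ ?_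
  rw [weilWindowSesq_indicator_pow_chiOdd ha q i,
    show ((c q : ℝ) : ℂ) * ((((1 / Real.sqrt 2 : ℝ) : ℂ)) * (1 - (-1 : ℂ) ^ q) *
        weilWindowSesq a ((Icc (-a) a).indicator fun x : ℝ ↦ ((x : ℂ)) ^ q) (chi a i))
      = (((c q * (1 / Real.sqrt 2) * (1 - (-1 : ℝ) ^ q) : ℝ)) : ℂ) *
        weilWindowSesq a ((Icc (-a) a).indicator fun x : ℝ ↦ ((x : ℂ)) ^ q) (chi a i) by push_cast; ring,
    Complex.im_ofReal_mul, div_eq_iff hs0.ne']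
  field_simp
  rw [Real.sq_sqrt (by norm_num : (0 : ℝ) ≤ 2)]
  ring

end Summit.RiemannHypothesis.RiemannHypothesis.Theorems.WeilFormatC
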